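import Literature.Geometry.Symplectic.SteinDomain
import Literature.Geometry.Kaehler.ManifoldFormsPullback
import Literature.Topology.FourManifolds.ThickenedHandlebodyFour
import HarnessLib

/-!
# Stein structures on the `4`-dimensional `1`-handlebodies `{q(x, y) + z² + w² ≤ c} ⊂ ℂ²`

Topic `Literature/Geometry/Symplectic`; fact seat
`provefact-Literature.Geometry.Symplectic.Gompf1998` for Eliashberg's theorem without `2`-handles,
`Literature.Geometry.Symplectic.Gompf1998_thm13_noTwoHandles` (`SteinHandlebodies.lean`: every
compact orientable `4`-dimensional `1`-handlebody is a Stein domain; Gompf 1998, Thm. 1.3;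
Akbulut–Matveyev 1998, Thm. 2 (1)).  That fact quantifies over all such manifolds and its
proof factors through the classification of orientable `1`-handlebodies (the named facts NORM
`Literature.Topology.FourManifolds.exists_hasHandleDecomposition_handleCount_one` and UNIQ₄
`Literature.Topology.FourManifolds.nonempty_diffeomorph_of_hasHandleDecomposition_handleCount_one`
of `SPC4HandlesModelReduction.lean`), which identifies them with the **models**
`♮ᵏ (S¹ × B³)`.  This file supplies the geometric half: **the models are Stein domains**
(`IsSteinDomain`, `SteinDomain.lean`), for the tree's models of `♮ᵏ (S¹ × B³)` — the regular
sublevel sets `Y = {G ≤ c} ⊂ ℝ⁴`, `G(x, y, z, w) = q(x, y) + z² + w²`, of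
`ThickenedHandlebodyFour.lean` (`IsHoledDiscMorseFunction.FourThickening`: compact, connected,
orientable, one `0`-handle and `g` `1`-handles, existing in every genus).  Everything here is
**proved**; the only previously exhibited Stein domain of the tree was the ball `B⁴`
(`SteinBall.lean`, genus `0`).

## The construction (Gompf 1998, §2; Cieliebak–Eliashberg 2012, Ch. 2)

Gompf (1998), §2 presents `X₁ = ♮ⁿ S¹ × B³` as a strictly pseudoconvex domain of `ℂ²`
("a closed `ε`-neighborhood of `0 × iℝ` in `ℂ²`, modulo translations"); Akbulut–Matveyev
(1998), Thm. 2 (1): "the standard PC structure on `B⁴` can be extended over `1`-handles so that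
`X₁ = B⁴ ∪ (1-handles)` has pseudo-convex boundary".  Here the domain is `Y = {G ≤ c}` and the
complex structure is a *linear* one adapted to `G`:

* §1 `scaledComplexStructure λ = J_λ`, `J_λ (u₁, u₂) = (-λ⁻¹ u₂, λ u₁)` on
  `ℝ⁴ = ℝ²_{xy} ⊕ ℝ²_{zw}` (`J_λ² = -1`; `(ℝ⁴, J_λ) ≅ ℂ²` linearly).
* §2 Flat calculus for a constant complex structure `J₀` of `ℝ⁴`: the `1`-form
  `d^ℂΨ = dΨ ∘ J₀` (`dComplexFlat`), its exterior derivative in Mathlib's normalisation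
  (`extDeriv_dComplexFlat_apply`), the **Levi form**
  `-dd^ℂΨ (u, J₀ u) = D²Ψ(u, u) + D²Ψ(J₀ u, J₀ u)` (`neg_extDeriv_dComplexFlat_self`), and the
  vanishing of the flat Nijenhuis tensor of `J₀` (`flat_nijenhuis_eq_zero`).
* §3 **Tangent vectors of a regular sublevel set `{Ψ ≤ c} ⊂ ℝ⁴` read ambiently** (the
  dictionary of `ClosedBallTangent.lean` for the ball, redone for the tree's
  `Literature.Topology.FourManifolds.RegularSublevel` through Mathlib's pull-back of vector
  fields instead of explicit trivialisations): `inclDeriv x : ℝ⁴ ≃L ℝ⁴`, the differential of the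
  inclusion `ι` (`RegularSublevel.det_mfderiv_incl_ne_zero`); a vector field `X` is smooth iff
  `x ↦ Dι_x (X x)` is (`contMDiff_inclDeriv_apply`, `isSmoothVectorField_symm_apply`, by
  `ContMDiff.contMDiff_tangentMap` and `ContMDiffWithinAt.mpullback_vectorField_preimage`);
  `C^∞` functions on `{Ψ ≤ c}` extend to functions `C^∞` within `{Ψ ≤ c}`
  (`contDiffWithinAt_ambExt`, via the half-slice charts of `RegularSublevelSet.lean`);
  `{Ψ ≤ c}` has unique differentiability (`uniqueDiffWithinAt_sublevel`); Lie brackets are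
  ambient Lie brackets (`mlieBracket_eq_lieBracketWithin_ambExt`, Mathlib's
  `VectorField.mpullback_mlieBracketWithin`).
* §4 The transported structure `J_x = (Dι_x)⁻¹ ∘ J₀ ∘ Dι_x` (`sublevelJ`) and `φ = Ψ ∘ ι`
  (`sublevelPhi`): `J² = -1`, smoothness, **integrability** (`nijenhuis_sublevelJ_eq_zero`),
  `d^ℂφ = ι^*(d^ℂΨ)` (`dComplex_sublevel_eq_pullback`, the tree's `MForm.pullback`), hence by
  naturality of `d` (`Literature.Geometry.Kaehler.mextDeriv_pullback_apply`,
  `ManifoldFormsPullback.lean`) **the tree's Levi form of `φ` is the flat Levi form of `Ψ`**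
  (`neg_mextDeriv_dComplex_sublevel_self`); `∂{Ψ ≤ c} = {φ = c = max φ}`
  (`RegularSublevel.isBoundaryPoint_iff`) and `dφ ≠ 0` there.
* §5 For `G = q + z² + w²` with `q` a planar Morse function presenting a disc with `g` holes
  (`IsHoledDiscMorseFunction`): `D²G = D²q ⊕ 2 ⊕ 2`, `D²q ≥ -K` on the compact `{q ≤ c}`
  (`exists_hessian_bound`), so for `λ² = K + 1` the Levi form of `G` for `J_λ` dominates `‖u‖²`
  on `{G ≤ c}` (`levi_thicken₄_thicken`): **`G|_Y` is strictly `J_λ`-plurisubharmonic**.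
  Whence `exists_steinStructure_fourThickening` (a Stein structure on `Y` whose `J`-convex
  function *is* the Morse function `G|_Y` presenting the handle decomposition, as in Gompf's
  Thm. 1.3: "any such handle decomposition comes from a strictly plurisubharmonic function"),
  `isSteinDomain_fourThickening`, and **`exists_isSteinDomain_oneHandlebody`: for every `k` a
  compact connected orientable Stein domain with one `0`-handle and `k` `1`-handles exists**.

What remains for `Gompf1998_thm13_noTwoHandles` itself (recorded in the fact seat's notes):
transport of `IsSteinDomain` along the diffeomorphism onto the model given by NORM + UNIQ₄
(both unproved named facts of the tree), and the reduction to connected components.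

## References

* R. E. Gompf, *Handlebody construction of Stein surfaces*, Ann. of Math. 148 (1998), 619–693
  (arXiv:math/9803019), Thm. 1.3 and §2. [Gompf1998]
* S. Akbulut, R. Matveyev, *A convex decomposition theorem for 4-manifolds*, IMRN 1998, no. 7,
  371–381, Thm. 2 (1). [AkbulutMatveyev1998]
* K. Cieliebak, Ya. Eliashberg, *From Stein to Weinstein and back*, AMS Colloquium Publ. 59
  (2012), Ch. 2 (`J`-convex functions, the Levi form `-dd^ℂφ`). [CieliebakEliashberg2012]
* Ya. Eliashberg, *Topological characterization of Stein manifolds of dimension > 2*, Internat.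
  J. Math. 1 (1990), 29–46. [Eliashberg1990Stein]
-/

noncomputable section

open scoped Manifold ContDiff Topology
open Set Function Filter VectorField

namespace Literature.Geometry.Symplectic

open Literature.Topology.FourManifolds

/-- The model vector space `ℝ⁴` of the tangent spaces. [folklore] -/
local notation "E4" => EuclideanSpace ℝ (Fin 4)

/-! ### §1 The linear complex structures `J_λ` of `ℝ⁴ = ℝ²_{xy} ⊕ ℝ²_{zw}` -/

/-- The linear complex structure `J_λ (u₁, u₂) = (-λ⁻¹ u₂, λ u₁)` of `ℝ⁴ = ℝ²_{xy} ⊕ ℝ²_{zw}`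
(`λ ≠ 0`), i.e. `(x, y, z, w) ↦ (-z/λ, -w/λ, λ x, λ y)`, as a linear map; for `λ = 1` this is
multiplication by `i` in the complex coordinates `z₁ = x + i z`, `z₂ = y + i w`. [folklore] -/
def scaledComplexStructureLin (l : ℝ) : E4 →ₗ[ℝ] E4 where
  toFun v := WithLp.toLp 2 ![-(l⁻¹ * v 2), -(l⁻¹ * v 3), l * v 0, l * v 1]
  map_add' v w := by
    ext i; fin_cases i <;> simp <;> ring
  map_smul' c v := by
    ext i; fin_cases i <;> simp <;> ring

/-- The linear complex structure `J_λ` of `ℝ⁴` as a continuous linear map. [folklore] -/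
def scaledComplexStructure (l : ℝ) : E4 →L[ℝ] E4 :=
  LinearMap.toContinuousLinearMap (scaledComplexStructureLin l)

/-- Coordinate `0` of `J_λ v` is `-v₂/λ`. [folklore] -/
@[simp] theorem scaledComplexStructure_apply_zero (l : ℝ) (v : E4) :
    scaledComplexStructure l v 0 = -(l⁻¹ * v 2) := rfl

/-- Coordinate `1` of `J_λ v` is `-v₃/λ`. [folklore] -/
@[simp] theorem scaledComplexStructure_apply_one (l : ℝ) (v : E4) :
    scaledComplexStructure l v 1 = -(l⁻¹ * v 3) := rfl

/-- Coordinate `2` of `J_λ v` is `λ v₀`. [folklore] -/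
@[simp] theorem scaledComplexStructure_apply_two (l : ℝ) (v : E4) :
    scaledComplexStructure l v 2 = l * v 0 := rfl

/-- Coordinate `3` of `J_λ v` is `λ v₁`. [folklore] -/
@[simp] theorem scaledComplexStructure_apply_three (l : ℝ) (v : E4) :
    scaledComplexStructure l v 3 = l * v 1 := rfl

/-- `J_λ² = -1` for `λ ≠ 0`. [folklore] -/
theorem scaledComplexStructure_sq {l : ℝ} (hl : l ≠ 0) (v : E4) :
    scaledComplexStructure l (scaledComplexStructure l v) = -v := by
  ext i; fin_cases i <;> simp <;> field_simp

/-! ### §2 Flat calculus: `d^ℂ` of a function for a constant complex structure on `ℝ⁴` -/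

section Flat

variable (J₀ : E4 →L[ℝ] E4) (Ψ : E4 → ℝ)

/-- The continuous linear map `ℓ ↦ (ℓ ∘ J₀)` from linear functionals to `1`-forms on `ℝ⁴`
(Mathlib's `ContinuousAlternatingMap.ofSubsingleton`). [folklore] -/
def precompOneForm : (E4 →L[ℝ] ℝ) →L[ℝ] (E4 [⋀^Fin 1]→L[ℝ] ℝ) :=
  ((ContinuousAlternatingMap.ofSubsingletonLIE (𝕜 := ℝ) (E := E4) (F := ℝ) (0 : Fin 1)).toContinuousLinearEquiv :
      (E4 →L[ℝ] ℝ) →L[ℝ] (E4 [⋀^Fin 1]→L[ℝ] ℝ)).comp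
    ((ContinuousLinearMap.compL ℝ E4 E4 ℝ).flip J₀)

/-- `precompOneForm J₀ ℓ (v) = ℓ (J₀ v₀)`. [folklore] -/
@[simp] theorem precompOneForm_apply (ℓ : E4 →L[ℝ] ℝ) (v : Fin 1 → E4) :
    precompOneForm J₀ ℓ v = ℓ (J₀ (v 0)) := by
  simp [precompOneForm]

/-- **The flat `1`-form `d^ℂΨ = dΨ ∘ J₀`** of a function `Ψ` on `ℝ⁴` with respect to the
constant complex structure `J₀`: `w ↦ (v ↦ dΨ_w (J₀ v))`. [Cieliebak–Eliashberg 2012, §2.2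
(`d^ℂφ = dφ ∘ J`)] [folklore] -/
def dComplexFlat : E4 → E4 [⋀^Fin 1]→L[ℝ] ℝ := fun w => precompOneForm J₀ (fderiv ℝ Ψ w)

/-- `d^ℂΨ (w)(v) = dΨ_w (J₀ v₀)`. [folklore] -/
@[simp] theorem dComplexFlat_apply (w : E4) (v : Fin 1 → E4) :
    dComplexFlat J₀ Ψ w v = fderiv ℝ Ψ w (J₀ (v 0)) := by
  simp [dComplexFlat]

variable {Ψ}

/-- `d^ℂΨ` is smooth when `Ψ` is. [folklore] -/
theorem contDiff_dComplexFlat (hΨ : ContDiff ℝ ∞ Ψ) : ContDiff ℝ ∞ (dComplexFlat J₀ Ψ) :=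
  (precompOneForm J₀).contDiff.comp (hΨ.fderiv_right le_rfl)

/-- The derivative of `d^ℂΨ`: `D(d^ℂΨ)_w (a) = (D²Ψ_w a) ∘ J₀`. [folklore] -/
theorem hasFDerivAt_dComplexFlat (hΨ : ContDiff ℝ ∞ Ψ) (w : E4) :
    HasFDerivAt (dComplexFlat J₀ Ψ) ((precompOneForm J₀).comp (fderiv ℝ (fderiv ℝ Ψ) w)) w := by
  have h1 : ContDiff ℝ ∞ (fderiv ℝ Ψ) := hΨ.fderiv_right le_rfl
  have h2 : HasFDerivAt (fderiv ℝ Ψ) (fderiv ℝ (fderiv ℝ Ψ) w) w :=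
    ((h1.differentiable (by simp)) w).hasFDerivAt
  exact (precompOneForm J₀).hasFDerivAt.comp w h2

/-- `d^ℂΨ` is differentiable. [folklore] -/
theorem differentiable_dComplexFlat (hΨ : ContDiff ℝ ∞ Ψ) : Differentiable ℝ (dComplexFlat J₀ Ψ) :=
  (contDiff_dComplexFlat J₀ hΨ).differentiable (by simp)

/-- The derivative of `d^ℂΨ` in the direction `a`, evaluated: `D(d^ℂΨ)_w (a)(b) = D²Ψ_w (a)(J₀ b)`.
[folklore] -/
theorem fderiv_dComplexFlat_apply (hΨ : ContDiff ℝ ∞ Ψ) (w a : E4) (v : Fin 1 → E4) :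
    fderiv ℝ (dComplexFlat J₀ Ψ) w a v = fderiv ℝ (fderiv ℝ Ψ) w a (J₀ (v 0)) := by
  rw [(hasFDerivAt_dComplexFlat J₀ hΨ w).fderiv]
  simp

/-- The derivative of the evaluated form `x ↦ d^ℂΨ (x)(v)` in the direction `a` is
`D²Ψ_w (a)(J₀ v₀)`. [folklore] -/
theorem fderiv_dComplexFlat_eval (hΨ : ContDiff ℝ ∞ Ψ) (w a : E4) (v : Fin 1 → E4) :
    fderiv ℝ (fun x => dComplexFlat J₀ Ψ x v) w a = fderiv ℝ (fderiv ℝ Ψ) w a (J₀ (v 0)) := by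
  have h1 : ContDiff ℝ ∞ (fderiv ℝ Ψ) := hΨ.fderiv_right le_rfl
  have hd : DifferentiableAt ℝ (fderiv ℝ Ψ) w := (h1.differentiable (by simp)) w
  simp only [dComplexFlat_apply]
  rw [fderiv_clm_apply hd (differentiableAt_const _)]
  simp

/-- **`dd^ℂΨ` for a constant complex structure** (Mathlib's normalisation
`dα(a, b) = Dα(a)·b - Dα(b)·a`): `dd^ℂΨ_w (a, b) = D²Ψ_w(a, J₀ b) - D²Ψ_w(b, J₀ a)`. [folklore] -/
theorem extDeriv_dComplexFlat_apply (hΨ : ContDiff ℝ ∞ Ψ) (w a b : E4) :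
    extDeriv (dComplexFlat J₀ Ψ) w ![a, b] =
      fderiv ℝ (fderiv ℝ Ψ) w a (J₀ b) - fderiv ℝ (fderiv ℝ Ψ) w b (J₀ a) := by
  rw [extDeriv_apply (differentiable_dComplexFlat J₀ hΨ w), Fin.sum_univ_two,
    fderiv_dComplexFlat_eval J₀ hΨ, fderiv_dComplexFlat_eval J₀ hΨ]
  have h0 : (Fin.removeNth 0 ![a, b]) 0 = b := rfl
  have h1 : (Fin.removeNth 1 ![a, b]) 0 = a := rfl
  rw [h0, h1]
  simp [sub_eq_add_neg]

/-- **The flat Levi form**: for `J₀² = -1`,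
`-dd^ℂΨ_w (u, J₀ u) = D²Ψ_w(u, u) + D²Ψ_w(J₀ u, J₀ u)`. [Cieliebak–Eliashberg 2012, §2.2] [folklore] -/
theorem neg_extDeriv_dComplexFlat_self (hΨ : ContDiff ℝ ∞ Ψ) (hJ : ∀ v, J₀ (J₀ v) = -v)
    (w u : E4) :
    -(extDeriv (dComplexFlat J₀ Ψ) w ![u, J₀ u]) =
      fderiv ℝ (fderiv ℝ Ψ) w u u + fderiv ℝ (fderiv ℝ Ψ) w (J₀ u) (J₀ u) := by
  rw [extDeriv_dComplexFlat_apply J₀ hΨ, hJ, map_neg]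
  ring

/-! #### The flat Nijenhuis tensor of a constant complex structure vanishes -/

variable {J₀}

/-- The derivative within a set of `J₀ ∘ V` is `J₀ ∘ DV`. [folklore] -/
theorem fderivWithin_const_clm_comp {V : E4 → E4} {s : Set E4} {w : E4}
    (hV : DifferentiableWithinAt ℝ V s w) (hs : UniqueDiffWithinAt ℝ s w) :
    fderivWithin ℝ (fun w' => J₀ (V w')) s w = J₀.comp (fderivWithin ℝ V s w) :=
  (J₀.hasFDerivAt.comp_hasFDerivWithinAt w hV.hasFDerivWithinAt).fderivWithin hs

/-- **The Nijenhuis tensor of a constant complex structure `J₀` of `ℝ⁴` vanishes** (flat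
computation within any set of unique differentiability):
`[J₀V, J₀W] - J₀[J₀V, W] - J₀[V, J₀W] - [V, W] = 0`. [folklore] -/
theorem flat_nijenhuis_eq_zero (hJ : ∀ v, J₀ (J₀ v) = -v) {V W : E4 → E4} {s : Set E4} {w : E4}
    (hV : DifferentiableWithinAt ℝ V s w) (hW : DifferentiableWithinAt ℝ W s w)
    (hs : UniqueDiffWithinAt ℝ s w) :
    lieBracketWithin ℝ (fun w' => J₀ (V w')) (fun w' => J₀ (W w')) s w -
      J₀ (lieBracketWithin ℝ (fun w' => J₀ (V w')) W s w) -
      J₀ (lieBracketWithin ℝ V (fun w' => J₀ (W w')) s w) -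
      lieBracketWithin ℝ V W s w = 0 := by
  simp only [lieBracketWithin, fderivWithin_const_clm_comp hV hs, fderivWithin_const_clm_comp hW hs,
    ContinuousLinearMap.comp_apply, map_sub, hJ]
  abel

end Flat

/-! ### §3 Regular sublevel sets `{Ψ ≤ c} ⊂ ℝ⁴`: tangent vectors read in the ambient space -/

section Sublevel

variable {Ψ : E4 → ℝ} {c : ℝ} (h : IsRegularLevel (𝓡 4) Ψ c)

/-- **The differential of the inclusion `ι : {Ψ ≤ c} ↪ ℝ⁴` at `x`**, as a linear isomorphism
from `T_x{Ψ ≤ c}` (read in the preferred chart at `x`) onto `ℝ⁴`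
(`RegularSublevel.det_mfderiv_incl_ne_zero`). [folklore] -/
def inclDeriv (x : RegularSublevel h) : E4 ≃L[ℝ] E4 :=
  LinearEquiv.toContinuousLinearEquiv
    (LinearMap.equivOfDetNeZero
      (mfderiv (𝓡∂ 4) (𝓡 4) (RegularSublevel.incl h) x).toLinearMap
      (RegularSublevel.det_mfderiv_incl_ne_zero h x))

/-- `inclDeriv` is the manifold derivative of the inclusion. [folklore] -/
theorem coe_inclDeriv (x : RegularSublevel h) :
    (inclDeriv h x : E4 →L[ℝ] E4) = mfderiv (𝓡∂ 4) (𝓡 4) (RegularSublevel.incl h) x := by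
  ext v
  rfl

/-- `inclDeriv`, applied. [folklore] -/
theorem inclDeriv_apply (x : RegularSublevel h) (v : E4) :
    inclDeriv h x v = mfderiv (𝓡∂ 4) (𝓡 4) (RegularSublevel.incl h) x v := rfl

/-- The differential of the inclusion is invertible. [folklore] -/
theorem isInvertible_mfderiv_incl (x : RegularSublevel h) :
    (mfderiv (𝓡∂ 4) (𝓡 4) (RegularSublevel.incl h) x).IsInvertible :=
  ⟨inclDeriv h x, coe_inclDeriv h x⟩

/-- The inverse of the differential of the inclusion. [folklore] -/
theorem inverse_mfderiv_incl (x : RegularSublevel h) :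
    (mfderiv (𝓡∂ 4) (𝓡 4) (RegularSublevel.incl h) x).inverse =
      ((inclDeriv h x).symm : E4 →L[ℝ] E4) := by
  have key := ContinuousLinearMap.inverse_equiv (inclDeriv h x)
  rw [coe_inclDeriv] at key
  exact key

/-- The inclusion `{Ψ ≤ c} ↪ ℝ⁴` is smooth (`RegularSublevel.contMDiff_incl`, with the model
written `𝓡∂ 4`). [folklore] -/
theorem contMDiff_incl_four : ContMDiff (𝓡∂ 4) (𝓡 4) ∞ (RegularSublevel.incl h) :=
  RegularSublevel.contMDiff_incl h

/-- **Mathlib's pull-back of an ambient vector field along the inclusion** is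
`x ↦ (Dι_x)⁻¹ (V (ι x))`. [folklore] -/
theorem mpullback_incl (V : E4 → E4) (x : RegularSublevel h) :
    mpullback (𝓡∂ 4) (𝓡 4) (RegularSublevel.incl h) V x =
      (inclDeriv h x).symm (V (RegularSublevel.incl h x)) := by
  rw [mpullback_apply, inverse_mfderiv_incl]
  rfl

/-- The extended chart of `{Ψ ≤ c}` at `x` is the half-slice chart `Θₓ` of `ℝ⁴` at `x`
composed with the inclusion (on the chart source). [folklore] -/
theorem extChartAt_sublevel_apply {x y : RegularSublevel h}
    (hy : y ∈ (extChartAt (𝓡∂ 4) x).source) :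
    extChartAt (𝓡∂ 4) x y =
      ((RegularSublevel.halfSliceAtlas h).datum x).Θ (RegularSublevel.incl h y) := by
  rw [extChartAt_source] at hy
  exact ((RegularSublevel.halfSliceAtlas h).datum x).extend_chart_apply hy

/-- The half-slice chart `Θₓ` is `C^∞` at `ι x`. [folklore] -/
theorem contDiffAt_datum (x : RegularSublevel h) :
    ContDiffAt ℝ ∞ ((RegularSublevel.halfSliceAtlas h).datum x).Θ (RegularSublevel.incl h x) := by
  set D := (RegularSublevel.halfSliceAtlas h).datum x
  have hΘ : ContDiffOn ℝ ∞ D.Θ D.Θ.source := contMDiffOn_iff_contDiffOn.1 D.contMDiffOn_toFun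
  exact hΘ.contDiffAt (D.Θ.open_source.mem_nhds ((RegularSublevel.halfSliceAtlas h).mem_source x))

/-- The inverse half-slice chart `Θₓ⁻¹` is `C^∞` at `Θₓ (ι x)`. [folklore] -/
theorem contDiffAt_datum_symm (x : RegularSublevel h) :
    ContDiffAt ℝ ∞ ((RegularSublevel.halfSliceAtlas h).datum x).Θ.symm
      (((RegularSublevel.halfSliceAtlas h).datum x).Θ (RegularSublevel.incl h x)) := by
  set D := (RegularSublevel.halfSliceAtlas h).datum x
  have hΘ : ContDiffOn ℝ ∞ D.Θ.symm D.Θ.target := contMDiffOn_iff_contDiffOn.1 D.contMDiffOn_symm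
  exact hΘ.contDiffAt (D.Θ.open_target.mem_nhds
    (D.Θ.map_source ((RegularSublevel.halfSliceAtlas h).mem_source x)))

/-- The image under the inclusion of a neighbourhood of `x` in `{Ψ ≤ c}` is a neighbourhood of
`ι x` within the set `{Ψ ≤ c}`. [folklore] -/
theorem image_incl_mem_nhdsWithin {x : RegularSublevel h} {U : Set (RegularSublevel h)}
    (hU : U ∈ 𝓝 x) : RegularSublevel.incl h '' U ∈ 𝓝[Ψ ⁻¹' Iic c] (RegularSublevel.incl h x) := by
  have hmap : map (RegularSublevel.incl h) (𝓝 x) = 𝓝[Ψ ⁻¹' Iic c] (RegularSublevel.incl h x) :=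
    map_nhds_subtype_val x
  rw [← hmap]
  exact image_mem_map hU

/-- **The set `{Ψ ≤ c}` is a set of unique differentiability at each of its points** (it
contains the image of a half-space neighbourhood under the local diffeomorphism `Θₓ⁻¹`).
[folklore] -/
theorem uniqueDiffWithinAt_sublevel (x : RegularSublevel h) :
    UniqueDiffWithinAt ℝ (Ψ ⁻¹' Iic c) (RegularSublevel.incl h x) := by
  set D := (RegularSublevel.halfSliceAtlas h).datum x with hD
  have hxs : RegularSublevel.incl h x ∈ D.Θ.source := (RegularSublevel.halfSliceAtlas h).mem_source x
  set z₀ : E4 := D.Θ (RegularSublevel.incl h x) with hz₀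
  have hz₀t : z₀ ∈ D.Θ.target := D.Θ.map_source hxs
  set T : Set E4 := {z : E4 | 0 ≤ z 0} ∩ D.Θ.target with hT
  -- `T` is a set of unique differentiability at `z₀`
  have hTu : UniqueDiffWithinAt ℝ T z₀ := by
    have h1 : UniqueDiffWithinAt ℝ {z : E4 | 0 ≤ z 0} z₀ := by
      have hr := (𝓡∂ 4).uniqueDiffOn
      rw [range_modelWithCornersEuclideanHalfSpace] at hr
      exact hr z₀ (D.apply_zero_nonneg hxs x.2)
    exact h1.inter (D.Θ.open_target.mem_nhds hz₀t)
  -- the derivative of `Θ.symm` at `z₀` is onto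
  have hsymm : HasFDerivAt D.Θ.symm (fderiv ℝ D.Θ.symm z₀) z₀ :=
    ((contDiffAt_datum_symm h x).differentiableAt (by simp)).hasFDerivAt
  have hΘd : HasFDerivAt D.Θ (fderiv ℝ D.Θ (RegularSublevel.incl h x)) (RegularSublevel.incl h x) :=
    ((contDiffAt_datum h x).differentiableAt (by simp)).hasFDerivAt
  have hcomp : HasFDerivAt (D.Θ.symm ∘ D.Θ)
      ((fderiv ℝ D.Θ.symm z₀).comp (fderiv ℝ D.Θ (RegularSublevel.incl h x)))
      (RegularSublevel.incl h x) := hsymm.comp _ hΘd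
  have hid : HasFDerivAt (D.Θ.symm ∘ D.Θ) (ContinuousLinearMap.id ℝ E4) (RegularSublevel.incl h x) := by
    refine (hasFDerivAt_id _).congr_of_eventuallyEq ?_
    filter_upwards [D.Θ.open_source.mem_nhds hxs] with w hw
    exact D.Θ.left_inv hw
  have heq : (fderiv ℝ D.Θ.symm z₀).comp (fderiv ℝ D.Θ (RegularSublevel.incl h x)) =
      ContinuousLinearMap.id ℝ E4 := hcomp.unique hid
  have hsurj : Function.Surjective (fderiv ℝ D.Θ.symm z₀) := fun u =>
    ⟨fderiv ℝ D.Θ (RegularSublevel.incl h x) u, by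
      have := congrArg (fun L : E4 →L[ℝ] E4 => L u) heq
      simpa using this⟩
  have himage : UniqueDiffWithinAt ℝ (D.Θ.symm '' T) (D.Θ.symm z₀) :=
    hsymm.hasFDerivWithinAt.uniqueDiffWithinAt hTu hsurj.denseRange
  rw [hz₀, D.Θ.left_inv hxs] at himage
  refine himage.mono ?_
  rintro _ ⟨z, ⟨hz0, hz⟩, rfl⟩
  exact D.symm_mem hz hz0

/-! #### Ambient extension of functions on `{Ψ ≤ c}` -/

/-- The extension by zero of a function on `{Ψ ≤ c}` to `ℝ⁴` (only its values on `{Ψ ≤ c}`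
matter). [folklore] -/
def ambExt {F : Type*} [Zero F] (g : RegularSublevel h → F) (w : E4) : F :=
  if hw : Ψ w ≤ c then g (RegularSublevel.mk h w hw) else 0

/-- On `{Ψ ≤ c}` the extension is the given function. [folklore] -/
@[simp] theorem ambExt_incl {F : Type*} [Zero F] (g : RegularSublevel h → F) (x : RegularSublevel h) :
    ambExt h g (RegularSublevel.incl h x) = g x := by
  have hx : Ψ (RegularSublevel.incl h x) ≤ c := RegularSublevel.apply_incl_le h x
  rw [ambExt, dif_pos hx]
  rfl

/-- **A function which is `C^∞` on the manifold `{Ψ ≤ c}` has an extension which is `C^∞`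
within the set `{Ψ ≤ c} ⊆ ℝ⁴`** (compose with the half-slice chart, a local diffeomorphism of
`ℝ⁴` extending the preferred chart). [folklore] -/
theorem contDiffWithinAt_ambExt {F : Type*} [NormedAddCommGroup F] [NormedSpace ℝ F]
    {g : RegularSublevel h → F} {x : RegularSublevel h} (hg : ContMDiffAt (𝓡∂ 4) 𝓘(ℝ, F) ∞ g x) :
    ContDiffWithinAt ℝ ∞ (ambExt h g) (Ψ ⁻¹' Iic c) (RegularSublevel.incl h x) := by
  set D := (RegularSublevel.halfSliceAtlas h).datum x with hD
  rw [contMDiffAt_iff] at hg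
  obtain ⟨-, hg⟩ := hg
  simp only [extChartAt_model_space_eq_id, PartialEquiv.refl_coe, CompTriple.comp_eq] at hg
  have hxx : extChartAt (𝓡∂ 4) x x = D.Θ (RegularSublevel.incl h x) :=
    (RegularSublevel.halfSliceAtlas h).extChartAt_self_apply x
  rw [hxx] at hg
  -- compose with the half-slice chart on the image `A` of the chart source
  set A : Set E4 := RegularSublevel.incl h '' (extChartAt (𝓡∂ 4) x).source with hA
  have hΘ : ContDiffWithinAt ℝ ∞ D.Θ A (RegularSublevel.incl h x) :=
    (contDiffAt_datum h x).contDiffWithinAt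
  have hmaps : MapsTo D.Θ A (range (𝓡∂ 4)) := by
    rintro _ ⟨y, hy, rfl⟩
    rw [← extChartAt_sublevel_apply h hy]
    exact extChartAt_target_subset_range x ((extChartAt (𝓡∂ 4) x).map_source hy)
  have hcomp : ContDiffWithinAt ℝ ∞ ((g ∘ (extChartAt (𝓡∂ 4) x).symm) ∘ D.Θ) A
      (RegularSublevel.incl h x) := hg.comp (RegularSublevel.incl h x) hΘ hmaps
  have hAn : A ∈ 𝓝[Ψ ⁻¹' Iic c] (RegularSublevel.incl h x) :=
    image_incl_mem_nhdsWithin h (extChartAt_source_mem_nhds (I := 𝓡∂ 4) x)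
  refine (hcomp.congr (fun w hw => ?_) ?_).mono_of_mem_nhdsWithin hAn
  · obtain ⟨y, hy, rfl⟩ := hw
    rw [ambExt_incl, comp_apply, comp_apply, ← extChartAt_sublevel_apply h hy,
      (extChartAt (𝓡∂ 4) x).left_inv hy]
  · rw [ambExt_incl, comp_apply, comp_apply,
      ← extChartAt_sublevel_apply h (mem_extChartAt_source x),
      (extChartAt (𝓡∂ 4) x).left_inv (mem_extChartAt_source x)]

/-- The extension of a `C^∞` function is differentiable within `{Ψ ≤ c}`. [folklore] -/
theorem differentiableWithinAt_ambExt {F : Type*} [NormedAddCommGroup F] [NormedSpace ℝ F]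
    {g : RegularSublevel h → F} {x : RegularSublevel h} (hg : ContMDiffAt (𝓡∂ 4) 𝓘(ℝ, F) ∞ g x) :
    DifferentiableWithinAt ℝ (ambExt h g) (Ψ ⁻¹' Iic c) (RegularSublevel.incl h x) :=
  (contDiffWithinAt_ambExt h hg).differentiableWithinAt (by simp)

/-! #### Smooth vector fields of `{Ψ ≤ c}` are the smooth ambient representatives -/

/-- **A smooth vector field of `{Ψ ≤ c}`, read ambiently (`x ↦ Dι_x (X x)`), is a smooth
`ℝ⁴`-valued function** (the bundled derivative of the inclusion is smooth). [folklore] -/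
theorem contMDiff_inclDeriv_apply {X : (x : RegularSublevel h) → TangentSpace (𝓡∂ 4) x}
    (hX : IsSmoothVectorField (RegularSublevel h) X) :
    ContMDiff (𝓡∂ 4) 𝓘(ℝ, E4) ∞ fun x => inclDeriv h x (X x) := by
  have h1 : ContMDiff (𝓡∂ 4).tangent (𝓡 4).tangent ∞
      (tangentMap (𝓡∂ 4) (𝓡 4) (RegularSublevel.incl h)) :=
    (contMDiff_incl_four h).contMDiff_tangentMap le_rfl
  have h2 := (contMDiff_snd_tangentBundle_modelSpace E4 (𝓡 4)).comp (h1.comp hX)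
  exact h2

/-- **Conversely, `x ↦ (Dι_x)⁻¹ (g x)` is a smooth vector field of `{Ψ ≤ c}` for every smooth
`g : {Ψ ≤ c} → ℝ⁴`** (it is Mathlib's pull-back along the inclusion of the ambient extension
of `g`, smooth within `{Ψ ≤ c}`; `ContMDiffWithinAt.mpullback_vectorField_preimage`). [folklore] -/
theorem isSmoothVectorField_symm_apply {g : RegularSublevel h → E4}
    (hg : ContMDiff (𝓡∂ 4) 𝓘(ℝ, E4) ∞ g) :
    IsSmoothVectorField (RegularSublevel h) fun x => (inclDeriv h x).symm (g x) := by
  intro x₀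
  have hV : ContMDiffWithinAt (𝓡 4) (𝓡 4).tangent ∞
      (fun w : E4 => (Bundle.TotalSpace.mk' E4 w (ambExt h g w) : TangentBundle (𝓡 4) E4))
      (Ψ ⁻¹' Iic c) (RegularSublevel.incl h x₀) :=
    contMDiffWithinAt_vectorSpace_iff_contDiffWithinAt.2 (contDiffWithinAt_ambExt h (hg x₀))
  have key := ContMDiffWithinAt.mpullback_vectorField_preimage (I := 𝓡∂ 4) (I' := 𝓡 4)
    (f := RegularSublevel.incl h) (V := ambExt h g) hV
    ((contMDiff_incl_four h) x₀) (isInvertible_mfderiv_incl h x₀) le_rfl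
  have huniv : RegularSublevel.incl h ⁻¹' (Ψ ⁻¹' Iic c) = univ := eq_univ_of_forall fun x => x.2
  rw [huniv, contMDiffWithinAt_univ] at key
  refine key.congr_of_eventuallyEq (Eventually.of_forall fun x => ?_)
  show (Bundle.TotalSpace.mk' E4 x ((inclDeriv h x).symm (g x)) :
      TangentBundle (𝓡∂ 4) (RegularSublevel h)) =
    Bundle.TotalSpace.mk' E4 x (mpullback (𝓡∂ 4) (𝓡 4) (RegularSublevel.incl h) (ambExt h g) x)
  rw [mpullback_incl, ambExt_incl]

/-- **Lie brackets of `{Ψ ≤ c}` are ambient Lie brackets**: for smooth vector fields `X`, `Y`,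
`Dι_x [X, Y](x)` is the Lie bracket within `{Ψ ≤ c}` of the ambient representatives
(Mathlib's `VectorField.mpullback_mlieBracketWithin` along the inclusion). [folklore] -/
theorem mlieBracket_eq_lieBracketWithin_ambExt
    {X Y : (x : RegularSublevel h) → TangentSpace (𝓡∂ 4) x}
    (hX : IsSmoothVectorField (RegularSublevel h) X) (hY : IsSmoothVectorField (RegularSublevel h) Y)
    (x : RegularSublevel h) :
    mlieBracket (𝓡∂ 4) X Y x = (inclDeriv h x).symm
      (lieBracketWithin ℝ (ambExt h fun y => inclDeriv h y (X y))
        (ambExt h fun y => inclDeriv h y (Y y)) (Ψ ⁻¹' Iic c) (RegularSublevel.incl h x)) := by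
  haveI : IsManifold (𝓡∂ 4) (minSmoothness ℝ 2) (RegularSublevel h) := by
    rw [minSmoothness_of_isRCLikeNormedField]; infer_instance
  haveI : IsManifold (𝓡 4) (minSmoothness ℝ 2) E4 := by
    rw [minSmoothness_of_isRCLikeNormedField]; infer_instance
  have hVX : MDifferentiableWithinAt (𝓡 4) (𝓡 4).tangent
      (fun w : E4 => (Bundle.TotalSpace.mk' E4 w (ambExt h (fun y => inclDeriv h y (X y)) w) :
        TangentBundle (𝓡 4) E4)) (Ψ ⁻¹' Iic c) (RegularSublevel.incl h x) :=
    (contMDiffWithinAt_vectorSpace_iff_contDiffWithinAt.2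
      (contDiffWithinAt_ambExt h ((contMDiff_inclDeriv_apply h hX) x))).mdifferentiableWithinAt
      (by simp)
  have hVY : MDifferentiableWithinAt (𝓡 4) (𝓡 4).tangent
      (fun w : E4 => (Bundle.TotalSpace.mk' E4 w (ambExt h (fun y => inclDeriv h y (Y y)) w) :
        TangentBundle (𝓡 4) E4)) (Ψ ⁻¹' Iic c) (RegularSublevel.incl h x) :=
    (contMDiffWithinAt_vectorSpace_iff_contDiffWithinAt.2
      (contDiffWithinAt_ambExt h ((contMDiff_inclDeriv_apply h hY) x))).mdifferentiableWithinAt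
      (by simp)
  have key := mpullback_mlieBracketWithin (I := 𝓡∂ 4) (I' := 𝓡 4)
    (f := RegularSublevel.incl h) (V := ambExt h fun y => inclDeriv h y (X y))
    (W := ambExt h fun y => inclDeriv h y (Y y)) (x₀ := x) (s := univ) (t := Ψ ⁻¹' Iic c)
    (n := ∞) hVX hVY uniqueMDiffOn_univ ((contMDiff_incl_four h) x) (mem_univ _)
    (by rw [minSmoothness_of_isRCLikeNormedField]; exact ENat.LEInfty.out)
    (univ_mem' fun y => y.2)
  have hpX : mpullback (𝓡∂ 4) (𝓡 4) (RegularSublevel.incl h)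
      (ambExt h fun y => inclDeriv h y (X y)) = X := by
    funext y
    rw [mpullback_incl, ambExt_incl, ContinuousLinearEquiv.symm_apply_apply]
  have hpY : mpullback (𝓡∂ 4) (𝓡 4) (RegularSublevel.incl h)
      (ambExt h fun y => inclDeriv h y (Y y)) = Y := by
    funext y
    rw [mpullback_incl, ambExt_incl, ContinuousLinearEquiv.symm_apply_apply]
  rw [hpX, hpY, mlieBracketWithin_univ] at key
  rw [← key, mpullback_incl, mlieBracketWithin_eq_lieBracketWithin]

end Sublevel

/-! ### §4 A constant complex structure of `ℝ⁴` transported to `{Ψ ≤ c}`, and its Levi form -/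

section Transport

variable {Ψ : E4 → ℝ} {c : ℝ} (h : IsRegularLevel (𝓡 4) Ψ c) (J₀ : E4 →L[ℝ] E4)

/-- **The constant complex structure `J₀` of `ℝ⁴` on the tangent spaces of `{Ψ ≤ c}`, read in
the preferred charts**: `J_x = (Dι_x)⁻¹ ∘ J₀ ∘ Dι_x`. [folklore] -/
def sublevelJ (x : RegularSublevel h) : E4 →L[ℝ] E4 :=
  ((inclDeriv h x).symm : E4 →L[ℝ] E4).comp (J₀.comp (inclDeriv h x : E4 →L[ℝ] E4))

/-- Unfolding `sublevelJ`. [folklore] -/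
theorem sublevelJ_apply (x : RegularSublevel h) (v : E4) :
    sublevelJ h J₀ x v = (inclDeriv h x).symm (J₀ (inclDeriv h x v)) := rfl

/-- Read ambiently, `J_x` is `J₀`: `Dι_x (J_x v) = J₀ (Dι_x v)`. [folklore] -/
@[simp] theorem inclDeriv_sublevelJ (x : RegularSublevel h) (v : E4) :
    inclDeriv h x (sublevelJ h J₀ x v) = J₀ (inclDeriv h x v) := by
  rw [sublevelJ_apply, ContinuousLinearEquiv.apply_symm_apply]

/-- `J_x` on a pulled-back vector: `J_x ((Dι_x)⁻¹ u) = (Dι_x)⁻¹ (J₀ u)`. [folklore] -/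
theorem sublevelJ_symm_apply (x : RegularSublevel h) (u : E4) :
    sublevelJ h J₀ x ((inclDeriv h x).symm u) = (inclDeriv h x).symm (J₀ u) := by
  rw [sublevelJ_apply, ContinuousLinearEquiv.apply_symm_apply]

/-- `J² = -1` on `{Ψ ≤ c}` if `J₀² = -1`. [folklore] -/
theorem sublevelJ_sq (hJ : ∀ v, J₀ (J₀ v) = -v) (x : RegularSublevel h) (v : E4) :
    sublevelJ h J₀ x (sublevelJ h J₀ x v) = -v := by
  apply (inclDeriv h x).injective
  rw [inclDeriv_sublevelJ, inclDeriv_sublevelJ, hJ, map_neg]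

/-- **`J` is smooth**: it maps smooth vector fields of `{Ψ ≤ c}` to smooth vector fields.
[folklore] -/
theorem isSmoothVectorField_sublevelJ (X : (x : RegularSublevel h) → TangentSpace (𝓡∂ 4) x)
    (hX : IsSmoothVectorField (RegularSublevel h) X) :
    IsSmoothVectorField (RegularSublevel h) fun x => sublevelJ h J₀ x (X x) :=
  isSmoothVectorField_symm_apply h (J₀.contDiff.comp_contMDiff (contMDiff_inclDeriv_apply h hX))

/-- The ambient representative of `J X` is `J₀` applied to that of `X`. [folklore] -/
theorem ambExt_inclDeriv_sublevelJ (X : (x : RegularSublevel h) → TangentSpace (𝓡∂ 4) x) :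
    ambExt h (fun y => inclDeriv h y (sublevelJ h J₀ y (X y))) =
      fun w => J₀ (ambExt h (fun y => inclDeriv h y (X y)) w) := by
  funext w
  by_cases hw : Ψ w ≤ c
  · rw [ambExt, dif_pos hw, ambExt, dif_pos hw, inclDeriv_sublevelJ]
  · rw [ambExt, dif_neg hw, ambExt, dif_neg hw, map_zero]

/-- **`J` is integrable** if `J₀² = -1`: the Nijenhuis tensor of `J` vanishes on smooth vector
fields of `{Ψ ≤ c}` (everything is the pull-back along the inclusion of the flat computation
for the constant `J₀`). [folklore] -/
theorem nijenhuis_sublevelJ_eq_zero (hJ : ∀ v, J₀ (J₀ v) = -v)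
    {X Y : (x : RegularSublevel h) → TangentSpace (𝓡∂ 4) x}
    (hX : IsSmoothVectorField (RegularSublevel h) X) (hY : IsSmoothVectorField (RegularSublevel h) Y)
    (x : RegularSublevel h) : nijenhuis (RegularSublevel h) (sublevelJ h J₀) X Y x = 0 := by
  have hJX := isSmoothVectorField_sublevelJ h J₀ X hX
  have hJY := isSmoothVectorField_sublevelJ h J₀ Y hY
  have hdX := differentiableWithinAt_ambExt h ((contMDiff_inclDeriv_apply h hX) x)
  have hdY := differentiableWithinAt_ambExt h ((contMDiff_inclDeriv_apply h hY) x)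
  simp only [nijenhuis]
  rw [mlieBracket_eq_lieBracketWithin_ambExt h hJX hJY, mlieBracket_eq_lieBracketWithin_ambExt h hJX hY,
    mlieBracket_eq_lieBracketWithin_ambExt h hX hJY, mlieBracket_eq_lieBracketWithin_ambExt h hX hY,
    ambExt_inclDeriv_sublevelJ, ambExt_inclDeriv_sublevelJ, sublevelJ_symm_apply,
    sublevelJ_symm_apply, ← map_sub, ← map_sub, ← map_sub,
    flat_nijenhuis_eq_zero hJ hdX hdY (uniqueDiffWithinAt_sublevel h x), map_zero]
  rfl

/-! #### The defining function `φ = Ψ|_{Ψ ≤ c}` and the `1`-form `d^ℂφ` -/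

/-- The restriction `φ = Ψ ∘ ι` of `Ψ` to `{Ψ ≤ c}`. [folklore] -/
def sublevelPhi : RegularSublevel h → ℝ := fun x => Ψ (RegularSublevel.incl h x)

/-- Unfolding `sublevelPhi`. [folklore] -/
theorem sublevelPhi_apply (x : RegularSublevel h) : sublevelPhi h x = Ψ (RegularSublevel.incl h x) :=
  rfl

/-- `Ψ` is `C^∞` (it has a regular level). [folklore] -/
theorem contDiff_of_isRegularLevel (h : IsRegularLevel (𝓡 4) Ψ c) : ContDiff ℝ ∞ Ψ :=
  contMDiff_iff_contDiff.1 h.contMDiff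

/-- `φ` is `C^∞`. [folklore] -/
theorem contMDiff_sublevelPhi : ContMDiff (𝓡∂ 4) 𝓘(ℝ, ℝ) ∞ (sublevelPhi h) :=
  (contDiff_of_isRegularLevel h).comp_contMDiff (contMDiff_incl_four h)

/-- `φ ≤ c`. [folklore] -/
theorem sublevelPhi_le (x : RegularSublevel h) : sublevelPhi h x ≤ c :=
  RegularSublevel.apply_incl_le h x

/-- **The differential of `φ`**: `dφ_x = dΨ_{ι x} ∘ Dι_x`. [folklore] -/
theorem mfderiv_sublevelPhi (x : RegularSublevel h) :
    mfderiv (𝓡∂ 4) 𝓘(ℝ, ℝ) (sublevelPhi h) x =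
      (fderiv ℝ Ψ (RegularSublevel.incl h x)).comp (inclDeriv h x : E4 →L[ℝ] E4) := by
  have hΨ : MDifferentiableAt (𝓡 4) 𝓘(ℝ, ℝ) Ψ (RegularSublevel.incl h x) :=
    ((contDiff_of_isRegularLevel h).differentiable (by simp) _).mdifferentiableAt
  have hι : MDifferentiableAt (𝓡∂ 4) (𝓡 4) (RegularSublevel.incl h) x :=
    (contMDiff_incl_four h x).mdifferentiableAt (by simp)
  rw [show sublevelPhi h = Ψ ∘ RegularSublevel.incl h from rfl, mfderiv_comp x hΨ hι, mfderiv_eq_fderiv]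
  rfl

/-- `dφ_x (v) = dΨ_{ι x} (Dι_x v)`. [folklore] -/
theorem mfderiv_sublevelPhi_apply (x : RegularSublevel h) (v : E4) :
    mfderiv (𝓡∂ 4) 𝓘(ℝ, ℝ) (sublevelPhi h) x v = fderiv ℝ Ψ (RegularSublevel.incl h x) (inclDeriv h x v) := by
  rw [mfderiv_sublevelPhi]
  rfl

/-- **`d^ℂφ = dφ ∘ J` is the flat `d^ℂΨ` read through `Dι`**:
`(dφ_x ∘ J_x)(v) = dΨ_{ι x} (J₀ (Dι_x v))`. [folklore] -/
theorem dComplex_sublevel_apply (x : RegularSublevel h) (v : Fin 1 → E4) :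
    dComplex (sublevelJ h J₀) (sublevelPhi h) x v =
      fderiv ℝ Ψ (RegularSublevel.incl h x) (J₀ (inclDeriv h x (v 0))) := by
  rw [dComplex_apply, mfderiv_sublevelPhi_apply, inclDeriv_sublevelJ]

/-- The same, as an identity of forms: `d^ℂφ = ι^* (d^ℂΨ)` (the tree's manifold pull-back
`Literature.Geometry.Kaehler.MForm.pullback`). [folklore] -/
theorem dComplex_sublevel_eq_pullback :
    dComplex (sublevelJ h J₀) (sublevelPhi h) =
      Kaehler.MForm.pullback (I' := 𝓡 4) (𝓡∂ 4) (RegularSublevel.incl h) (dComplexFlat J₀ Ψ) := by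
  funext x
  ext v
  rw [dComplex_sublevel_apply, Kaehler.MForm.pullback_apply]
  erw [dComplexFlat_apply]
  rfl

/-- A `C^∞` form on the vector space `ℝ⁴` is smooth at every point in the tree's chart-wise
sense (`MForm.SmoothAt`; the charts of `ℝ⁴` are the identity). [folklore] -/
theorem smoothAt_flat {k : ℕ} {α : E4 → E4 [⋀^Fin k]→L[ℝ] ℝ} (hα : ContDiff ℝ ∞ α) (w : E4) :
    Kaehler.MForm.SmoothAt (I := 𝓡 4) (M := E4) α w := by
  have hc : Kaehler.MForm.inChart (I := 𝓡 4) (M := E4) α w = α := by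
    funext y
    ext v
    simp [Kaehler.MForm.inChart_apply]
    rfl
  unfold Kaehler.MForm.SmoothAt
  rw [hc]
  exact hα.contDiffAt.contDiffWithinAt

/-- **The manifold exterior derivative of `d^ℂφ` at `x` is the pull-back of the flat `dd^ℂΨ`**:
`dd^ℂφ_x = (dd^ℂΨ)_{ι x} ∘ (Dι_x × Dι_x)` (naturality of `d`,
`Literature.Geometry.Kaehler.mextDeriv_pullback_apply`, and `mextDeriv = extDeriv` on `ℝ⁴`).
[folklore] -/
theorem mextDeriv_dComplex_sublevel (x : RegularSublevel h) :
    Kaehler.mextDeriv (dComplex (sublevelJ h J₀) (sublevelPhi h)) x =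
      (extDeriv (dComplexFlat J₀ Ψ) (RegularSublevel.incl h x)).compContinuousLinearMap
        (inclDeriv h x : E4 →L[ℝ] E4) := by
  have hf : ∀ᶠ z in 𝓝 x, ContMDiffAt (𝓡∂ 4) (𝓡 4) ∞ (RegularSublevel.incl h) z :=
    Eventually.of_forall fun z => contMDiff_incl_four h z
  have hβ : Kaehler.MForm.SmoothAt (I := 𝓡 4) (M := E4) (dComplexFlat J₀ Ψ) (RegularSublevel.incl h x) :=
    smoothAt_flat (contDiff_dComplexFlat J₀ (contDiff_of_isRegularLevel h)) _
  rw [dComplex_sublevel_eq_pullback, Kaehler.mextDeriv_pullback_apply hf hβ]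
  ext v
  rw [Kaehler.MForm.pullback_apply, Kaehler.mextDeriv_eq_extDeriv]
  rfl

/-- **The Levi form of `φ` on `{Ψ ≤ c}` is the flat Levi form of `Ψ` on ambient vectors**: for
`J₀² = -1`, `-dd^ℂφ_x (v, J_x v) = D²Ψ_{ι x}(u, u) + D²Ψ_{ι x}(J₀ u, J₀ u)` with `u = Dι_x v`.
[folklore] -/
theorem neg_mextDeriv_dComplex_sublevel_self (hJ : ∀ v, J₀ (J₀ v) = -v) (x : RegularSublevel h)
    (v : E4) :
    -(Kaehler.mextDeriv (dComplex (sublevelJ h J₀) (sublevelPhi h)) x ![v, sublevelJ h J₀ x v]) =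
      fderiv ℝ (fderiv ℝ Ψ) (RegularSublevel.incl h x) (inclDeriv h x v) (inclDeriv h x v) +
        fderiv ℝ (fderiv ℝ Ψ) (RegularSublevel.incl h x) (J₀ (inclDeriv h x v))
          (J₀ (inclDeriv h x v)) := by
  rw [mextDeriv_dComplex_sublevel]
  change -(extDeriv (dComplexFlat J₀ Ψ) (RegularSublevel.incl h x)
    ((inclDeriv h x : E4 →L[ℝ] E4) ∘ ![v, sublevelJ h J₀ x v])) = _
  have hv : ((inclDeriv h x : E4 →L[ℝ] E4) ∘ ![v, sublevelJ h J₀ x v]) =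
      ![inclDeriv h x v, J₀ (inclDeriv h x v)] := by
    funext i
    fin_cases i
    · rfl
    · simp [inclDeriv_sublevelJ]
  rw [hv, neg_extDeriv_dComplexFlat_self J₀ (contDiff_of_isRegularLevel h) hJ]

/-! #### The boundary `{Ψ = c}` is the regular maximum level set of `φ` -/

/-- A point of `{Ψ ≤ c}` is a boundary point iff `φ = c` there
(`RegularSublevel.isBoundaryPoint_iff`). [folklore] -/
theorem isBoundaryPoint_iff_sublevelPhi_eq (x : RegularSublevel h) :
    (𝓡∂ 4).IsBoundaryPoint x ↔ sublevelPhi h x = c :=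
  RegularSublevel.isBoundaryPoint_iff h x

/-- If the level `{Ψ = c}` is nonempty, `sup φ = c` on `{Ψ ≤ c}`. [folklore] -/
theorem sSup_range_sublevelPhi (hne : ∃ w, Ψ w = c) : sSup (range (sublevelPhi h)) = c := by
  obtain ⟨w, hw⟩ := hne
  have h1 : IsGreatest (range (sublevelPhi h)) c := by
    refine ⟨⟨RegularSublevel.mk h w hw.le, hw⟩, ?_⟩
    rintro _ ⟨x, rfl⟩
    exact sublevelPhi_le h x
  exact h1.csSup_eq

/-- **The boundary of `{Ψ ≤ c}` is the maximum level set of `φ`** (when the level is nonempty).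
[folklore] -/
theorem isBoundaryPoint_iff_sublevelPhi_eq_sSup (hne : ∃ w, Ψ w = c) (x : RegularSublevel h) :
    (𝓡∂ 4).IsBoundaryPoint x ↔ sublevelPhi h x = sSup (range (sublevelPhi h)) := by
  rw [sSup_range_sublevelPhi h hne, isBoundaryPoint_iff_sublevelPhi_eq]

/-- **`φ` is regular on the boundary**: `c` is a regular value of `Ψ` and `Dι_x` is onto.
[folklore] -/
theorem mfderiv_sublevelPhi_ne_zero {x : RegularSublevel h} (hx : (𝓡∂ 4).IsBoundaryPoint x) :
    mfderiv (𝓡∂ 4) 𝓘(ℝ, ℝ) (sublevelPhi h) x ≠ 0 := by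
  rw [isBoundaryPoint_iff_sublevelPhi_eq] at hx
  have hreg : ¬ IsMCriticalPt (𝓡 4) Ψ (RegularSublevel.incl h x) := h.not_isMCriticalPt hx
  intro h0
  apply hreg
  have hf : fderiv ℝ Ψ (RegularSublevel.incl h x) = 0 := by
    ext u
    have h1 := mfderiv_sublevelPhi_apply h x ((inclDeriv h x).symm u)
    rw [h0, ContinuousLinearEquiv.apply_symm_apply] at h1
    exact h1.symm
  show mfderiv (𝓡 4) 𝓘(ℝ, ℝ) Ψ (RegularSublevel.incl h x) = 0
  rw [mfderiv_eq_fderiv, hf]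
  rfl

end Transport

/-! ### §5 The Stein structure on `{q(x, y) + z² + w² ≤ c} ⊂ ℝ⁴` -/

section Model

open SolidThickening PlanarThickening

/-- The model plane `ℝ²`. [folklore] -/
local notation "E2" => EuclideanSpace ℝ (Fin 2)

/-- The `(x, y)`-part of a vector of `ℝ⁴`. [folklore] -/
def xyPart (u : E4) : E2 := WithLp.toLp 2 ![u 0, u 1]

/-- The `(z, w)`-part of a vector of `ℝ⁴`. [folklore] -/
def zwPart (u : E4) : E2 := WithLp.toLp 2 ![u 2, u 3]

/-- `π₂ ∘ π₃` is the `(x, y)`-part. [folklore] -/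
theorem proj_proj₃ (u : E4) : proj (proj₃ u) = xyPart u := by
  ext i; fin_cases i <;> rfl

/-- The `(x, y)`-part of `J_λ u` is `-λ⁻¹` times the `(z, w)`-part of `u`. [folklore] -/
theorem proj_proj₃_scaledComplexStructure (l : ℝ) (u : E4) :
    proj (proj₃ (scaledComplexStructure l u)) = (-l⁻¹) • zwPart u := by
  ext i; fin_cases i <;> simp [zwPart]

/-- The `(x, y)`-part of `J_λ u` is `-λ⁻¹` times the `(z, w)`-part of `u`. [folklore] -/
theorem xyPart_scaledComplexStructure (l : ℝ) (u : E4) :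
    xyPart (scaledComplexStructure l u) = (-l⁻¹) • zwPart u := by
  rw [← proj_proj₃, proj_proj₃_scaledComplexStructure]

/-- `‖(u₀, u₁)‖² = u₀² + u₁²`. [folklore] -/
theorem norm_sq_xyPart (u : E4) : ‖xyPart u‖ ^ 2 = u 0 ^ 2 + u 1 ^ 2 := by
  rw [EuclideanSpace.norm_sq_eq]
  simp [xyPart, Fin.sum_univ_two, sq_abs]

/-- `‖(u₂, u₃)‖² = u₂² + u₃²`. [folklore] -/
theorem norm_sq_zwPart (u : E4) : ‖zwPart u‖ ^ 2 = u 2 ^ 2 + u 3 ^ 2 := by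
  rw [EuclideanSpace.norm_sq_eq]
  simp [zwPart, Fin.sum_univ_two, sq_abs]

/-- `‖u‖² = u₀² + u₁² + u₂² + u₃²` on `ℝ⁴`. [folklore] -/
theorem norm_sq_four (u : E4) : ‖u‖ ^ 2 = u 0 ^ 2 + u 1 ^ 2 + u 2 ^ 2 + u 3 ^ 2 := by
  rw [EuclideanSpace.norm_sq_eq]
  simp [Fin.sum_univ_four, sq_abs]

/-- The elementary inequality behind the choice `λ² = K + 1`: if `A ≥ -K |a|²` and `B ≥ -K |b|²`
then `|a|² + |b|² ≤ (A + 2|b|²) + (λ⁻² B + 2 λ² |a|²)`. [folklore] -/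
theorem levi_ineq {K l A B a0 a1 b0 b1 : ℝ} (hK : 0 ≤ K) (hl : l ^ 2 = K + 1)
    (hA : -(K * (a0 ^ 2 + a1 ^ 2)) ≤ A) (hB : -(K * (b0 ^ 2 + b1 ^ 2)) ≤ B) :
    a0 ^ 2 + a1 ^ 2 + b0 ^ 2 + b1 ^ 2 ≤
      (A + 2 * b0 ^ 2 + 2 * b1 ^ 2) + (l⁻¹ ^ 2 * B + 2 * l ^ 2 * a0 ^ 2 + 2 * l ^ 2 * a1 ^ 2) := by
  have hl0 : 0 < l ^ 2 := by rw [hl]; linarith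
  have hm : l⁻¹ ^ 2 * (K + 1) = 1 := by rw [← hl, inv_pow, inv_mul_cancel₀ hl0.ne']
  have hm0 : 0 ≤ l⁻¹ ^ 2 := sq_nonneg _
  have h1 : -(l⁻¹ ^ 2 * (K * (b0 ^ 2 + b1 ^ 2))) ≤ l⁻¹ ^ 2 * B := by
    have := mul_le_mul_of_nonneg_left hB hm0
    linarith
  have h2 : l⁻¹ ^ 2 * K ≤ 1 := by nlinarith
  have hb : 0 ≤ b0 ^ 2 + b1 ^ 2 := by positivity
  have h3 : l⁻¹ ^ 2 * (K * (b0 ^ 2 + b1 ^ 2)) ≤ b0 ^ 2 + b1 ^ 2 := by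
    have := mul_le_mul_of_nonneg_right h2 hb
    linarith
  nlinarith [sq_nonneg a0, sq_nonneg a1]

variable {g : ℕ} {q : E2 → ℝ} {c : ℝ} (h : IsHoledDiscMorseFunction g q c)
include h

/-- `{q ≤ c}` is compact (`q` is coercive). [folklore] -/
theorem isCompact_planar_sublevel : IsCompact (q ⁻¹' Iic c) := by
  obtain ⟨B, hB⟩ := h.exists_bound
  refine Metric.isCompact_of_isClosed_isBounded (isClosed_Iic.preimage h.continuous) ?_
  rw [isBounded_iff_forall_norm_le]
  refine ⟨|c + B| + 1, fun u hu => ?_⟩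
  have hu' : q u ≤ c := hu
  have h1 : ‖u‖ ^ 2 ≤ c + B := by have := hB u; linarith
  nlinarith [norm_nonneg u, abs_nonneg (c + B), le_abs_self (c + B), sq_nonneg (‖u‖ - 1)]

/-- **A uniform lower bound for the Hessian of `q` on the compact set `{q ≤ c}`**:
`D²q_z(a, a) ≥ -K ‖a‖²`. [folklore] -/
theorem exists_hessian_bound :
    ∃ K : ℝ, 0 ≤ K ∧ ∀ z : E2, q z ≤ c → ∀ a : E2, -(K * ‖a‖ ^ 2) ≤ fderiv ℝ (fderiv ℝ q) z a a := by
  have hq : ContDiff ℝ ∞ q := PlanarThickening.contDiff_of_isMorse h.isMorse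
  have hc : Continuous (fderiv ℝ (fderiv ℝ q)) :=
    ((hq.fderiv_right le_rfl).fderiv_right (m := ∞) le_rfl).continuous
  obtain ⟨K, hK⟩ := (isCompact_planar_sublevel h).exists_bound_of_continuousOn
    (f := fderiv ℝ (fderiv ℝ q)) hc.continuousOn
  refine ⟨max K 0, le_max_right _ _, fun z hz a => ?_⟩
  have h1 : ‖fderiv ℝ (fderiv ℝ q) z a a‖ ≤ ‖fderiv ℝ (fderiv ℝ q) z‖ * ‖a‖ * ‖a‖ :=
    ContinuousLinearMap.le_opNorm₂ _ _ _
  have h2 : ‖fderiv ℝ (fderiv ℝ q) z‖ ≤ max K 0 := (hK z hz).trans (le_max_left _ _)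
  have h3 : |fderiv ℝ (fderiv ℝ q) z a a| ≤ max K 0 * ‖a‖ ^ 2 := by
    rw [← Real.norm_eq_abs]
    calc ‖fderiv ℝ (fderiv ℝ q) z a a‖ ≤ ‖fderiv ℝ (fderiv ℝ q) z‖ * ‖a‖ * ‖a‖ := h1
      _ ≤ max K 0 * ‖a‖ * ‖a‖ := by gcongr
      _ = max K 0 * ‖a‖ ^ 2 := by ring
  exact (abs_le.1 h3).1

/-- **The Levi form of `G = q(x, y) + z² + w²` for `J_λ`, `λ² = K + 1`, dominates `‖u‖²` on
`{G ≤ c}`**: `D²G_w(u, u) + D²G_w(J_λ u, J_λ u) ≥ ‖u‖²`, since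
`D²G = D²q ⊕ 2 ⊕ 2`, `D²q ≥ -K` on `{q ≤ c} ⊇ π({G ≤ c})`, and `J_λ` exchanges the `(x, y)`- and
`(z, w)`-planes with weights `λ^{∓1}`. [folklore] -/
theorem levi_thicken₄_thicken {K : ℝ} (hK0 : 0 ≤ K)
    (hK : ∀ z : E2, q z ≤ c → ∀ a : E2, -(K * ‖a‖ ^ 2) ≤ fderiv ℝ (fderiv ℝ q) z a a)
    {l : ℝ} (hl : l ^ 2 = K + 1) {w : E4} (hw : thicken₄ (thicken q) w ≤ c) (u : E4) :
    ‖u‖ ^ 2 ≤ fderiv ℝ (fderiv ℝ (thicken₄ (thicken q))) w u u +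
      fderiv ℝ (fderiv ℝ (thicken₄ (thicken q))) w (scaledComplexStructure l u)
        (scaledComplexStructure l u) := by
  have hq2 : ContDiff ℝ 2 q := (PlanarThickening.contDiff_of_isMorse h.isMorse).of_le (by norm_cast)
  have hF2 : ContDiff ℝ 2 (thicken q) :=
    (contDiff_thicken (PlanarThickening.contDiff_of_isMorse h.isMorse)).of_le (by norm_cast)
  have hz : q (xyPart w) ≤ c := by
    rw [← proj_proj₃]
    exact (le_thicken q (proj₃ w)).trans ((le_thicken₄ (thicken q) w).trans hw)
  have hA := hK _ hz (xyPart u)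
  have hB := hK _ hz (zwPart u)
  rw [norm_sq_xyPart] at hA
  rw [norm_sq_zwPart] at hB
  rw [fderiv_fderiv_thicken₄_apply hF2, fderiv_fderiv_thicken₄_apply hF2,
    fderiv_fderiv_thicken_apply hq2, fderiv_fderiv_thicken_apply hq2, norm_sq_four]
  simp only [proj_proj₃, xyPart_scaledComplexStructure, map_smul, FunLike.coe_smul,
    Pi.smul_apply, smul_eq_mul, proj₃_apply_two, scaledComplexStructure_apply_two,
    scaledComplexStructure_apply_three]
  have key := levi_ineq (A := fderiv ℝ (fderiv ℝ q) (xyPart w) (xyPart u) (xyPart u))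
    (B := fderiv ℝ (fderiv ℝ q) (xyPart w) (zwPart u) (zwPart u)) hK0 hl hA hB
  have e1 : -l⁻¹ * (-l⁻¹ * fderiv ℝ (fderiv ℝ q) (xyPart w) (zwPart u) (zwPart u)) =
      l⁻¹ ^ 2 * fderiv ℝ (fderiv ℝ q) (xyPart w) (zwPart u) (zwPart u) := by ring
  nlinarith [key, e1]

/-- The level `{G = c}` is nonempty. [folklore] -/
theorem exists_thicken₄_thicken_eq : ∃ w : E4, thicken₄ (thicken q) w = c := by
  obtain ⟨z, hz⟩ := h.exists_apply_eq
  exact ⟨lift₃ (lift z), by rw [thicken₄_lift₃, thicken_lift, hz]⟩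

/-- **The Stein structure on the `4`-dimensional `1`-handlebody
`Y = {q(x, y) + z² + w² ≤ c} ⊂ ℝ⁴`** (`IsHoledDiscMorseFunction.FourThickening`): the constant
complex structure `J_λ` of `ℝ⁴ ≅ ℂ²` (`λ² = K + 1`, `K` a Hessian bound for `q` on `{q ≤ c}`),
read in the charts of `Y` through the differential of the inclusion, and the defining Morse
function `φ = G|_Y`, `G = q + z² + w²`, which is strictly `J_λ`-plurisubharmonic on `Y` with
regular maximum level set `∂Y = {G = c}` — so that the handle decomposition of `Y` into one
`0`-handle and `g` `1`-handles (`hasHandleDecomposition_fourThickening`, presented by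
`G|_Y + (1 - c)`) is induced by the `J`-convex function of the Stein structure, as in Gompf
(1998), Thm. 1.3 ("any such handle decomposition comes from a strictly plurisubharmonic
function (with `∂X` a level set)") and §2 (`X₁ = ♮ⁿ S¹ × B³ ⊂ ℂ²`); Akbulut–Matveyev (1998),
Thm. 2 (1): "the standard PC structure on `B⁴` can be extended over `1`-handles".
[cite: Gompf1998, Thm. 1.3 and §2] -/
theorem exists_steinStructure_fourThickening :
    ∃ S : SteinStructure h.FourThickening,
      S.φ = sublevelPhi h.isRegularLevel₄ ∧
        ∃ l : ℝ, 0 < l ∧ S.J = sublevelJ h.isRegularLevel₄ (scaledComplexStructure l) := by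
  obtain ⟨K, hK0, hK⟩ := exists_hessian_bound h
  set l : ℝ := Real.sqrt (K + 1) with hl
  have hl0 : 0 < l := Real.sqrt_pos.2 (by linarith)
  have hl2 : l ^ 2 = K + 1 := Real.sq_sqrt (by linarith)
  have hJ : ∀ v, scaledComplexStructure l (scaledComplexStructure l v) = -v :=
    scaledComplexStructure_sq hl0.ne'
  refine ⟨{ J := sublevelJ h.isRegularLevel₄ (scaledComplexStructure l)
            φ := sublevelPhi h.isRegularLevel₄
            J_sq := sublevelJ_sq _ _ hJ
            J_smooth := isSmoothVectorField_sublevelJ _ _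
            integrable := fun X Y hX hY x => nijenhuis_sublevelJ_eq_zero _ _ hJ hX hY x
            φ_smooth := contMDiff_sublevelPhi _
            convex := fun x v hv => ?_
            boundary_eq := isBoundaryPoint_iff_sublevelPhi_eq_sSup _ (exists_thicken₄_thicken_eq h)
            regular := fun x hx => mfderiv_sublevelPhi_ne_zero _ hx }, rfl, l, hl0, rfl⟩
  rw [neg_mextDeriv_dComplex_sublevel_self _ _ hJ]
  have hu : inclDeriv h.isRegularLevel₄ x v ≠ 0 := fun h0 =>
    hv ((inclDeriv h.isRegularLevel₄ x).map_eq_zero_iff.1 h0)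
  have hpos : 0 < ‖inclDeriv h.isRegularLevel₄ x v‖ ^ 2 := by positivity
  exact hpos.trans_le
    (levi_thicken₄_thicken h hK0 hK hl2 (RegularSublevel.apply_incl_le h.isRegularLevel₄ x) _)

/-- **The `4`-dimensional `1`-handlebody `{q(x, y) + z² + w² ≤ c}` is a Stein domain**
(`IsSteinDomain`, `SteinDomain.lean`). [cite: Gompf1998, Thm. 1.3 and §2] -/
theorem isSteinDomain_fourThickening : IsSteinDomain h.FourThickening := by
  obtain ⟨S, -, -⟩ := exists_steinStructure_fourThickening h
  exact ⟨S⟩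

omit h in
/-- **Compact connected orientable Stein `1`-handlebodies exist in every genus**: for every `k`
there is a compact connected orientable smooth `4`-manifold with boundary (in `Type`, Hausdorff,
second countable) with a handle decomposition into one `0`-handle and `k` `1`-handles — hence a
`1`-handlebody, classically `♮ᵏ (S¹ × B³)` — which is a Stein domain; namely the sublevel set
`{q(x, y) + z² + w² ≤ c} ⊂ ℂ²` of `Literature.Topology.FourManifolds.exists_oneHandlebody_four`
with the Stein structure of `exists_steinStructure_fourThickening`.  This is the conclusion of
Eliashberg's theorem `Gompf1998_thm13_noTwoHandles` (`SteinHandlebodies.lean`) on the models;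
Gompf (1998), §2: `X₁ = ♮ⁿ S¹ × B³` "inherits a Stein structure"; Akbulut–Matveyev (1998),
Thm. 2 (1). [cite: Gompf1998, Thm. 1.3 and §2] -/
theorem exists_isSteinDomain_oneHandlebody (k : ℕ) :
    ∃ (V : Type) (_ : TopologicalSpace V) (_ : T2Space V) (_ : SecondCountableTopology V)
      (_ : CompactSpace V) (_ : ConnectedSpace V) (_ : ChartedSpace (EuclideanHalfSpace 4) V)
      (_ : IsManifold (𝓡∂ 4) ∞ V),
      IsOrientable (𝓡∂ 4) V ∧ HasHandleDecomposition 3 V (handleCount 1 k) ∧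
        IsHandlebodyOfIndexLE 3 1 V ∧ IsSteinDomain V := by
  obtain ⟨q, c, h⟩ := exists_isHoledDiscMorseFunction k
  exact ⟨h.FourThickening, inferInstance, inferInstance, inferInstance,
    h.compactSpace_fourThickening, h.connectedSpace_fourThickening, inferInstance, inferInstance,
    h.isOrientable_fourThickening, h.hasHandleDecomposition_fourThickening,
    h.isHandlebodyOfIndexLE_fourThickening, isSteinDomain_fourThickening h⟩

end Model

end Literature.Geometry.Symplectic
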